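import Summits.QuantumFields.BalabanUV.Beta.FP.TorusGeneratorIntertwining
import Summits.QuantumFields.BalabanUV.Beta.FP.NestedStepLawTransportedDeadRows

/-!
# `BalabanUV.Beta.FP.TorusGeneratorIntertwiningTwo` — road «FP» for binder row D1, ROUTE T, presentation T-β: **(T-β-4) AT ORDER 2 ON THE TORUS IS THE
# PRODUCT RULE TWICE — the TIP RULE `Tip · C₁(λ) = diagonal(λ∘tip) · Tip`, hence the order-2 intertwining letter `j2` of `NestedStepLawTorusTransported`
# holds EXACTLY for the EXPONENTIAL (parallel-transporter) closed form of the generator jets, with `W♯₂ := W₂^{(h+Dλ)}` and `C₂ := (c•C₁)²`**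

WHAT.  `TorusGeneratorIntertwining` (leaf-06 g18, p320573) proved the product rule (★) `diagonal(λ∘base)·W₀ + diagonal(Dλ)·Tip = W₀·C₁(λ)` for the torus
call's generator `W₀ = fromCols D₂ D₁` and from it the ORDER-1 letter `j1` of the OWNER d1-p3's torus call «transport first» (`NestedStepLawTorusTransported`
(B) p320614; instantiated with `j1` discharged in leaf-02 g19's `NestedStepLawTorusTransportedRowsJ1` p321955), for the field transport `X := −(c • diagonal
(λ∘base))` and the generator first jet in the row-ultralocal TIP-contact closed form `W₁^{(w)} = of (fun b e => −(c·w b·Tip b e))` (leaf-02 p314580 ∕ p318378,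
`weightedJet_eq`).  The ORDER-2 letter
  `j2 : X·X·W₀ + 2 • (−X·W₁) + W₂ = W♯₂ + 2 • (W♯₁·(c•C₁)) + W₀·C₂`
(the `u²`-term of `A′(u)·W(u) = W♯(u)·C(u)`) was left displayed: it needs the nested chart's generator SECOND jet `W₂`.  This module:
* §1 **THE TIP RULE** `torus_tipRule`: `Tip · C₁(λ) = diagonal(λ∘base + Dλ) · Tip` — evaluation at the tip of a bond intertwines «multiplication by `λ` in the
  gauge-mode basis» (`C₁(λ)`, `hC₁` VERBATIM from p320573) with multiplication by `λ(tip) = λ(base) + (Dλ)`; fine columns `torus_tipRule_fine`, coarse columns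
  `torus_tipRule_coarse` (the small-block root case: `λ̄(t) = λ` at the root).  ((★) is the tip rule minus the base rule; the tip rule is the new atom.)
* §2 **`torus_j2`**: IF the nested chart's generator jets along the weight `h` are the EXPONENTIAL (parallel-transporter) ones — `W₁^{(h)} = −c·diag(h)·Tip`
  (leaf-02's, as at order 1) AND **`W₂^{(h)} = c²·diag(h)²·Tip`** (closed form `of (fun b e => (c·h b)^2·Tip b e)`; DISPLAYED as the hypothesis `hW₂` — the
  `u²`-term of `ξ ↦ e^{−u c h_b}·ξ(tip b) − ξ(base b)`, i.e. of the abelian-shadow covariant derivative along the shifted background; whether the literal's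
  `W₂` IS this is the dictionary's ∕ leaf-02's `c2` row — PREDICTION, not asserted) — THEN `j2` holds EXACTLY with **`W♯₂ := W₂^{(h+Dλ)}`** and
  **`C₂ := (c•C₁)·(c•C₁)`** (the one-parameter group; `uC` then by `torus_uC_exp`), for EVERY `h` and EVERY site function `λ`: (★) twice + the tip rule,
  then a scalar identity per entry.  The conclusion is the (B)∕RowsJ1 binder `j2` VERBATIM at `C₂ := c•C₁ * (c•C₁)`.  The hypothesis-free parent
  **`torus_j2_shift`**: for an ARBITRARY second generator jet `W₂`, `j2` holds with `W♯₂ := W₂ + c²·((h+Dλ)² − h²)·Tip` DISPLAYED (the content of `j2` is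
  the NAME of `W♯₂`; the exponential case is the one in which the shift is absorbed).
* §3 the four dead rows in these closed forms, BY NAME over `NestedStepLawTransportedDeadRows` (p319750): `torus_p1_of_dead`∕`torus_p2_of_dead` (`P·W♯ₙ = 0`
  from `h + Dλ = 0` on the big-comb bonds), `torus_s1_of_dead`∕`torus_s2_of_dead` (`τ₁·Wₙ = 0` from `h = 0` on the small-comb bonds) — so after this file the
  generator side of (B) (`j1 j2 uC p1 p2 s1 s2`) is discharged from EXACTLY: the two closed forms, `h + Dλ` big-comb-dead, `h` small-comb-dead.
NOT HERE: what `λ` and `h` are for the literal, the `c2`∕`t2`∕`a2`∕`k2`∕`q2` rows (tables), any estimate.  Under the colour lift (δ) (OWNER F-FP-18-3 ∕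
`D1BFx.ColourLift`) every identity here lifts by one `mul_kronecker_mul` rewrite; under the nested-slice reading (α) it is an unused but true table identity.

HONEST DEPENDENCY (page 1, mandatory): continuum YM on T⁴ ⇐ BetaPertH ∧ nine spine estimates (0/9 proved); BetaPertH ⇐ (D1) ∧ (D4) ∧ CAP+tail;
G-an2-4 gates asym, D1 and NE2/3/4.  HONEST FRAMING (cell contract, verbatim): «discharging `BetaPertH` makes Bałaban's UV stability UNCONDITIONAL —
a real constructive-QFT result; it is NOT the continuum limit and NOT the Clay problem.»  ABSOLUTE RULE (cell charter, verbatim): «No internally-minted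
statement may enter as a cited fact. Every hypothesis is either kernel-proved in this package or a verbatim quotation of a PUBLISHED theorem with page
reference. The manuscript(s) under audit are NOT citable for their own disputed steps — they are the thing under adjudication; programme-internal
(2001/route/tribunal) claims are never citable.»  [folklore] product-rule algebra on OUR typed torus objects (`tgrad`, `tgradBlock`, `tdelta`, `Res`); no `def`,
no `def … : Prop`, nothing cited, 0 sorry; 0 estimates; 0∕4 row-D1 binders; NOT the dictionary, NOT (T-ID), NOT SDF, NOT D1, NOT BetaPertH, NOT continuum,
NOT Clay.  «not in print; our bookkeeping».
Provenance: D1 formalisation swarm LEAF PROVER 06, unit b2b-balaban-beta-d1-formalise-leaf-06 gen 19, 2026-08-22.  No existing file touched.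
-/

noncomputable section

open scoped BigOperators

namespace Summit.QuantumFields.BalabanUV.Beta.FP.TorusGeneratorIntertwiningTwo

open Finset Matrix
open Literature.MathematicalPhysics.QuantumFieldTheory.Balaban1983to89
open Literature.MathematicalPhysics.QuantumFieldTheory.Balaban1983to89.Beta
open Literature.MathematicalPhysics.QuantumFieldTheory.LatticeForm (quo)
open B5Prop11Plancherel (fine)
open B6Lemma24Torus (pbox mem_pbox)
open AffineAveraging (Site box toSite unitVec)
open OneStepResolventKernel (Fib)
open Summit.QuantumFields.BalabanUV.Beta.AxialDressingRooted (IsCombBondAt)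
open Summit.QuantumFields.BalabanUV.Beta.FP.KernelPeriodisationFib (Idx)
open Summit.QuantumFields.BalabanUV.Beta.FP.TorusCombForest (rootOf)
open Summit.QuantumFields.BalabanUV.Beta.FP.TorusCombRows (Res combRowsT)
open Summit.QuantumFields.BalabanUV.Beta.FP.TorusCombNestedBasis (quo_mem_pbox resBigEquiv)
open Summit.QuantumFields.BalabanUV.Beta.FP.TorusGaugeCovariance (tdelta tgrad tgrad_inl tdelta_of_mem)
open Summit.QuantumFields.BalabanUV.Beta.FP.TorusGaugeCovariancePairing (wrapPt wrapPt_of_mem tdelta_eq_ite_wrapPt sum_tdelta_mul)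
open Summit.QuantumFields.BalabanUV.Beta.FP.TorusGaugeCovarianceCoarse (tgradBlock tdelta_quo_wrapPt)
open Summit.QuantumFields.BalabanUV.Beta.GAN24.FineReadoutCauchyFrame (toSite_mem_range)
open Summit.QuantumFields.BalabanUV.Beta.FP.TorusGeneratorIntertwining (sum_tgrad_mul_eq rootOf_eq_smul_quo_add sum_res_eq_sum_box torus_productRule)
open Summit.QuantumFields.BalabanUV.Beta.FP.NestedStepLawTransportedDeadRows (torus_p_of_vanish_on_bigComb torus_s_of_vanish_on_smallComb)

variable {d : ℕ}

/-! ## §1 THE TIP RULE: evaluation at the tip intertwines `C₁(λ)` with multiplication by `λ(tip) = λ(base) + Dλ` -/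

section TipRule

variable (M' : Fin (d + 1) → ℕ) [∀ μ, NeZero (M' μ)] {Lc : ℕ} [NeZero Lc] {r r' : Fin (d + 1) → ℕ}

/-- [folklore] **TIP RULE, FINE COLUMNS**: `Tip_fine · diagonal(λ∘val) = diagonal(λ∘base + Dλ) · Tip_fine` — at the fine residual site `s = tip b` both sides
read `λ(tip b)` (`λ(base b) + (Dλ)(b) = λ(wrap(base b + e))`, `sum_tgrad_mul_eq`). -/
theorem torus_tipRule_fine (lam : ↥(pbox (fine Lc M')) → ℝ) :
    Matrix.of (fun (b : ↥(pbox (fine Lc M')) × Fin (d + 1)) (s : Res (toSite r) Lc (fine Lc M')) =>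
          tdelta (fine Lc M') ((b.1 : Site (d + 1)) + unitVec b.2) s.1)
        * Matrix.diagonal (fun s : Res (toSite r) Lc (fine Lc M') => lam s.1)
      = Matrix.diagonal (fun b : ↥(pbox (fine Lc M')) × Fin (d + 1) => lam b.1 + ∑ s, tgrad (fine Lc M') (b.1, Sum.inl b.2) s * lam s)
        * Matrix.of (fun (b : ↥(pbox (fine Lc M')) × Fin (d + 1)) (s : Res (toSite r) Lc (fine Lc M')) =>
          tdelta (fine Lc M') ((b.1 : Site (d + 1)) + unitVec b.2) s.1) := by
  ext b s
  simp only [Matrix.mul_diagonal, Matrix.diagonal_mul, Matrix.of_apply, sum_tgrad_mul_eq, add_sub_cancel, tdelta_eq_ite_wrapPt]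
  by_cases h1 : wrapPt (fine Lc M') ((b.1 : Site (d + 1)) + unitVec b.2) = s.1
  · rw [if_pos h1, h1]; ring
  · rw [if_neg h1]; ring

/-- [folklore] **TIP RULE, COARSE COLUMNS**: `Tip_coarse · diagonal(λ̄) + Tip_fine · (of fun s t => (λ s − λ̄ t)·[block s = t]) = diagonal(λ∘base + Dλ) · Tip_coarse`
(`λ̄ t = λ` at the small-block root `Lc•t + toSite r`): if the tip is a non-root fine site of block `t` the correction term restores `λ(tip) − λ̄(t)`; if the tip IS
the root, the correction vanishes and `λ̄(t) = λ(tip)`. -/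
theorem torus_tipRule_coarse (lam : ↥(pbox (fine Lc M')) → ℝ) :
    Matrix.of (fun (b : ↥(pbox (fine Lc M')) × Fin (d + 1)) (t : Res (toSite r') Lc M') => tdelta M' (quo Lc ((b.1 : Site (d + 1)) + unitVec b.2)) t.1)
          * Matrix.diagonal (fun t : Res (toSite r') Lc M' =>
              ∑ s, tdelta (fine Lc M') ((Lc : ℤ) • ((t.1 : ↥(pbox M')) : Site (d + 1)) + toSite r) s * lam s)
        + Matrix.of (fun (b : ↥(pbox (fine Lc M')) × Fin (d + 1)) (s : Res (toSite r) Lc (fine Lc M')) =>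
              tdelta (fine Lc M') ((b.1 : Site (d + 1)) + unitVec b.2) s.1)
          * Matrix.of (fun (s : Res (toSite r) Lc (fine Lc M')) (t : Res (toSite r') Lc M') =>
              (lam s.1 - ∑ s', tdelta (fine Lc M') ((Lc : ℤ) • ((t.1 : ↥(pbox M')) : Site (d + 1)) + toSite r) s' * lam s')
                * tdelta M' (quo Lc ((s.1 : ↥(pbox (fine Lc M'))) : Site (d + 1))) t.1)
      = Matrix.diagonal (fun b : ↥(pbox (fine Lc M')) × Fin (d + 1) => lam b.1 + ∑ s, tgrad (fine Lc M') (b.1, Sum.inl b.2) s * lam s)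
        * Matrix.of (fun (b : ↥(pbox (fine Lc M')) × Fin (d + 1)) (t : Res (toSite r') Lc M') =>
            tdelta M' (quo Lc ((b.1 : Site (d + 1)) + unitVec b.2)) t.1) := by
  have hLc : 0 < Lc := Nat.pos_of_ne_zero (NeZero.ne Lc)
  ext b t
  -- the residual sum re-extended over the box: the summand vanishes at the small-block roots
  have hres : ∑ s : Res (toSite r) Lc (fine Lc M'), tdelta (fine Lc M') ((b.1 : Site (d + 1)) + unitVec b.2) s.1
        * ((lam s.1 - ∑ s', tdelta (fine Lc M') ((Lc : ℤ) • ((t.1 : ↥(pbox M')) : Site (d + 1)) + toSite r) s' * lam s')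
          * tdelta M' (quo Lc ((s.1 : ↥(pbox (fine Lc M'))) : Site (d + 1))) t.1)
      = ∑ x : ↥(pbox (fine Lc M')), tdelta (fine Lc M') ((b.1 : Site (d + 1)) + unitVec b.2) x
        * ((lam x - ∑ s', tdelta (fine Lc M') ((Lc : ℤ) • ((t.1 : ↥(pbox M')) : Site (d + 1)) + toSite r) s' * lam s')
          * tdelta M' (quo Lc (x : Site (d + 1))) t.1) := by
    refine sum_res_eq_sum_box (fine Lc M') (fun x => tdelta (fine Lc M') ((b.1 : Site (d + 1)) + unitVec b.2) x
        * ((lam x - ∑ s', tdelta (fine Lc M') ((Lc : ℤ) • ((t.1 : ↥(pbox M')) : Site (d + 1)) + toSite r) s' * lam s')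
          * tdelta M' (quo Lc (x : Site (d + 1))) t.1)) fun x hx => ?_
    -- at a root `x = Lc • quo x + toSite r`: either the block is `t` (then `λ̄ = λ x`) or the indicator vanishes
    have hxq : (x : Site (d + 1)) = (Lc : ℤ) • quo Lc (x : Site (d + 1)) + toSite r := by
      rw [← rootOf_eq_smul_quo_add]; exact hx
    have hqmem : quo Lc (x : Site (d + 1)) ∈ pbox M' := quo_mem_pbox hLc x.2
    rw [tdelta_eq_ite_wrapPt M' (quo Lc (x : Site (d + 1)))]
    by_cases hq : wrapPt M' (quo Lc (x : Site (d + 1))) = t.1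
    · have hq' : quo Lc (x : Site (d + 1)) = ((t.1 : ↥(pbox M')) : Site (d + 1)) := by
        rw [← hq, TorusGaugeCovariancePairing.wrapPt_coe, B6Lemma24Torus.wrap_eq_self hqmem]
      have hbar : ∑ s', tdelta (fine Lc M') ((Lc : ℤ) • ((t.1 : ↥(pbox M')) : Site (d + 1)) + toSite r) s' * lam s' = lam x := by
        rw [← hq', ← hxq, sum_tdelta_mul, wrapPt_of_mem]
      rw [hbar, sub_self, zero_mul, mul_zero]
    · rw [if_neg hq, mul_zero, mul_zero]
  simp only [Matrix.add_apply, Matrix.mul_diagonal, Matrix.diagonal_mul, Matrix.of_apply]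
  rw [Matrix.mul_apply]
  simp only [Matrix.of_apply]
  rw [hres, sum_tdelta_mul, sum_tdelta_mul, tdelta_quo_wrapPt M' Lc ((b.1 : Site (d + 1)) + unitVec b.2) t.1, sum_tgrad_mul_eq, add_sub_cancel]
  ring

/-- [folklore] **THE TIP RULE**: for every site function `λ`, `Tip · C₁(λ) = diagonal(λ∘base + Dλ) · Tip` with `C₁(λ)` («multiplication by `λ` in the
gauge-mode basis») by its defining equation `hC₁` VERBATIM from `TorusGeneratorIntertwining.torus_productRule`, `Tip` the TIP-contact support of the generator
jets (`tdelta` at the tip: coarse class ∕ fine site), `(Dλ) b = Σ_s tgrad (fine Lc M′) (b.1, inl b.2) s · λ s`. -/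
theorem torus_tipRule (lam : ↥(pbox (fine Lc M')) → ℝ)
    {C₁ : Matrix (Res (toSite r') Lc M' ⊕ Res (toSite r) Lc (fine Lc M')) (Res (toSite r') Lc M' ⊕ Res (toSite r) Lc (fine Lc M')) ℝ}
    (hC₁ : C₁ = Matrix.fromBlocks
        (Matrix.diagonal fun t : Res (toSite r') Lc M' =>
          ∑ s, tdelta (fine Lc M') ((Lc : ℤ) • ((t.1 : ↥(pbox M')) : Site (d + 1)) + toSite r) s * lam s)
        (0 : Matrix (Res (toSite r') Lc M') (Res (toSite r) Lc (fine Lc M')) ℝ)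
        (Matrix.of fun (s : Res (toSite r) Lc (fine Lc M')) (t : Res (toSite r') Lc M') =>
          (lam s.1 - ∑ s', tdelta (fine Lc M') ((Lc : ℤ) • ((t.1 : ↥(pbox M')) : Site (d + 1)) + toSite r) s' * lam s')
            * tdelta M' (quo Lc ((s.1 : ↥(pbox (fine Lc M'))) : Site (d + 1))) t.1)
        (Matrix.diagonal fun s : Res (toSite r) Lc (fine Lc M') => lam s.1)) :
    Matrix.of (fun (b : ↥(pbox (fine Lc M')) × Fin (d + 1)) (e : Res (toSite r') Lc M' ⊕ Res (toSite r) Lc (fine Lc M')) =>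
          Sum.elim (fun t : Res (toSite r') Lc M' => tdelta M' (quo Lc ((b.1 : Site (d + 1)) + unitVec b.2)) t.1)
            (fun s : Res (toSite r) Lc (fine Lc M') => tdelta (fine Lc M') ((b.1 : Site (d + 1)) + unitVec b.2) s.1) e) * C₁
      = Matrix.diagonal (fun b : ↥(pbox (fine Lc M')) × Fin (d + 1) => lam b.1 + ∑ s, tgrad (fine Lc M') (b.1, Sum.inl b.2) s * lam s)
        * Matrix.of (fun (b : ↥(pbox (fine Lc M')) × Fin (d + 1)) (e : Res (toSite r') Lc M' ⊕ Res (toSite r) Lc (fine Lc M')) =>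
          Sum.elim (fun t : Res (toSite r') Lc M' => tdelta M' (quo Lc ((b.1 : Site (d + 1)) + unitVec b.2)) t.1)
            (fun s : Res (toSite r) Lc (fine Lc M') => tdelta (fine Lc M') ((b.1 : Site (d + 1)) + unitVec b.2) s.1) e) := by
  have hTip : (Matrix.of fun (b : ↥(pbox (fine Lc M')) × Fin (d + 1)) (e : Res (toSite r') Lc M' ⊕ Res (toSite r) Lc (fine Lc M')) =>
        Sum.elim (fun t : Res (toSite r') Lc M' => tdelta M' (quo Lc ((b.1 : Site (d + 1)) + unitVec b.2)) t.1)
          (fun s : Res (toSite r) Lc (fine Lc M') => tdelta (fine Lc M') ((b.1 : Site (d + 1)) + unitVec b.2) s.1) e)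
      = fromCols
          (Matrix.of fun (b : ↥(pbox (fine Lc M')) × Fin (d + 1)) (t : Res (toSite r') Lc M') => tdelta M' (quo Lc ((b.1 : Site (d + 1)) + unitVec b.2)) t.1)
          (Matrix.of fun (b : ↥(pbox (fine Lc M')) × Fin (d + 1)) (s : Res (toSite r) Lc (fine Lc M')) =>
            tdelta (fine Lc M') ((b.1 : Site (d + 1)) + unitVec b.2) s.1) := by
    ext b (t | s) <;> rfl
  rw [hTip, hC₁, Matrix.fromCols_mul_fromBlocks, Matrix.mul_fromCols, Matrix.mul_zero, zero_add, torus_tipRule_coarse M' lam,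
    torus_tipRule_fine M' lam]

end TipRule

/-! ## §2 `j2` EXACTLY for the exponential closed form of the generator jets: `W♯₂ := W₂^{(h+Dλ)}`, `C₂ := (c•C₁)²` -/

section OrderTwo

variable (M' : Fin (d + 1) → ℕ) [∀ μ, NeZero (M' μ)] {Lc : ℕ} [NeZero Lc] {r r' : Fin (d + 1) → ℕ}

/-- [folklore] **`j2` FOR AN ARBITRARY SECOND GENERATOR JET `W₂`: THE ONE-SHOT CHART's SECOND JET IS `W₂` SHIFTED BY THE ULTRALOCAL TIP CONTACT
`c²·((h+Dλ)² − h²)·Tip`, AT `C₂ := (c•C₁)·(c•C₁)`.**  With the torus call's `hD₁ hD₂`, the field transport `X := −(c • diagonal (λ∘base))`, the parameter-transport generator `C₁(λ)`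
(`hC₁` VERBATIM), the first generator jets in the closed forms `W₁ = of (−c·h b·Tip b e)`, `W♯₁ = of (−c·(h b + (Dλ) b)·Tip b e)` (as in `torus_j1`), the nested chart's
SECOND generator jet `W₂` FREE, and the one-shot chart's second jet DEFINED by the displayed shift
`hW₂' : W♯₂ = W₂ + of (((c·(h b + (Dλ) b))² − (c·h b)²)·Tip b e)`: for EVERY `h`, `λ`, `W₂`,
`X·X·W₀ + 2 • (−X·W₁) + W₂ = W♯₂ + 2 • (W♯₁·(c•C₁)) + W₀·(c•C₁·(c•C₁))` — (★) twice and the tip rule, then a scalar identity per entry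
(`−2λh + 2(h+δ)(λ+δ) − 2λδ − δ² = 2hδ + δ²`).  NO hypothesis on `W₂`: the content of `j2` is the NAME of `W♯₂`; what the dead row `p2` then needs of `W₂`
is read off (`torus_p2_of_dead`: the exponential rows on the big comb). -/
theorem torus_j2_shift (lam : ↥(pbox (fine Lc M')) → ℝ) (c : ℝ) (h : ↥(pbox (fine Lc M')) × Fin (d + 1) → ℝ)
    {D₁ : Matrix (↥(pbox (fine Lc M')) × Fin (d + 1)) (Res (toSite r) Lc (fine Lc M')) ℝ}
    {D₂ : Matrix (↥(pbox (fine Lc M')) × Fin (d + 1)) (Res (toSite r') Lc M') ℝ}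
    (hD₁ : D₁ = (tgrad (fine Lc M')).submatrix (fun b : ↥(pbox (fine Lc M')) × Fin (d + 1) => ((b.1, Sum.inl b.2) : Idx (fine Lc M') (Fib d)))
        (Subtype.val : Res (toSite r) Lc (fine Lc M') → ↥(pbox (fine Lc M'))))
    (hD₂ : D₂ = (tgradBlock M' Lc).submatrix (fun b : ↥(pbox (fine Lc M')) × Fin (d + 1) => ((b.1, Sum.inl b.2) : Idx (fine Lc M') (Fib d)))
        (Subtype.val : Res (toSite r') Lc M' → ↥(pbox M')))
    {C₁ : Matrix (Res (toSite r') Lc M' ⊕ Res (toSite r) Lc (fine Lc M')) (Res (toSite r') Lc M' ⊕ Res (toSite r) Lc (fine Lc M')) ℝ}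
    (hC₁ : C₁ = Matrix.fromBlocks
        (Matrix.diagonal fun t : Res (toSite r') Lc M' =>
          ∑ s, tdelta (fine Lc M') ((Lc : ℤ) • ((t.1 : ↥(pbox M')) : Site (d + 1)) + toSite r) s * lam s)
        (0 : Matrix (Res (toSite r') Lc M') (Res (toSite r) Lc (fine Lc M')) ℝ)
        (Matrix.of fun (s : Res (toSite r) Lc (fine Lc M')) (t : Res (toSite r') Lc M') =>
          (lam s.1 - ∑ s', tdelta (fine Lc M') ((Lc : ℤ) • ((t.1 : ↥(pbox M')) : Site (d + 1)) + toSite r) s' * lam s')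
            * tdelta M' (quo Lc ((s.1 : ↥(pbox (fine Lc M'))) : Site (d + 1))) t.1)
        (Matrix.diagonal fun s : Res (toSite r) Lc (fine Lc M') => lam s.1))
    {X : Matrix (↥(pbox (fine Lc M')) × Fin (d + 1)) (↥(pbox (fine Lc M')) × Fin (d + 1)) ℝ}
    (hX : X = -(c • Matrix.diagonal (fun b : ↥(pbox (fine Lc M')) × Fin (d + 1) => lam b.1)))
    {W₁ W₁' W₂ W₂' : Matrix (↥(pbox (fine Lc M')) × Fin (d + 1)) (Res (toSite r') Lc M' ⊕ Res (toSite r) Lc (fine Lc M')) ℝ}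
    (hW₁ : W₁ = Matrix.of fun (b : ↥(pbox (fine Lc M')) × Fin (d + 1)) (e : Res (toSite r') Lc M' ⊕ Res (toSite r) Lc (fine Lc M')) =>
        -(c * h b * Sum.elim (fun t : Res (toSite r') Lc M' => tdelta M' (quo Lc ((b.1 : Site (d + 1)) + unitVec b.2)) t.1)
          (fun s : Res (toSite r) Lc (fine Lc M') => tdelta (fine Lc M') ((b.1 : Site (d + 1)) + unitVec b.2) s.1) e))
    (hW₁' : W₁' = Matrix.of fun (b : ↥(pbox (fine Lc M')) × Fin (d + 1)) (e : Res (toSite r') Lc M' ⊕ Res (toSite r) Lc (fine Lc M')) =>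
        -(c * (h b + ∑ s, tgrad (fine Lc M') (b.1, Sum.inl b.2) s * lam s)
          * Sum.elim (fun t : Res (toSite r') Lc M' => tdelta M' (quo Lc ((b.1 : Site (d + 1)) + unitVec b.2)) t.1)
            (fun s : Res (toSite r) Lc (fine Lc M') => tdelta (fine Lc M') ((b.1 : Site (d + 1)) + unitVec b.2) s.1) e))
    (hW₂' : W₂' = W₂ + Matrix.of fun (b : ↥(pbox (fine Lc M')) × Fin (d + 1)) (e : Res (toSite r') Lc M' ⊕ Res (toSite r) Lc (fine Lc M')) =>
        ((c * (h b + ∑ s, tgrad (fine Lc M') (b.1, Sum.inl b.2) s * lam s)) ^ 2 - (c * h b) ^ 2)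
          * Sum.elim (fun t : Res (toSite r') Lc M' => tdelta M' (quo Lc ((b.1 : Site (d + 1)) + unitVec b.2)) t.1)
            (fun s : Res (toSite r) Lc (fine Lc M') => tdelta (fine Lc M') ((b.1 : Site (d + 1)) + unitVec b.2) s.1) e) :
    X * X * fromCols D₂ D₁ + (2 : ℝ) • (-X * W₁) + W₂ = W₂' + (2 : ℝ) • (W₁' * (c • C₁)) + fromCols D₂ D₁ * (c • C₁ * (c • C₁)) := by
  -- names: the tip contact `T`, `λ(base)`, `Dλ`, the weights
  set T : Matrix (↥(pbox (fine Lc M')) × Fin (d + 1)) (Res (toSite r') Lc M' ⊕ Res (toSite r) Lc (fine Lc M')) ℝ :=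
    Matrix.of (fun (b : ↥(pbox (fine Lc M')) × Fin (d + 1)) (e : Res (toSite r') Lc M' ⊕ Res (toSite r) Lc (fine Lc M')) =>
      Sum.elim (fun t : Res (toSite r') Lc M' => tdelta M' (quo Lc ((b.1 : Site (d + 1)) + unitVec b.2)) t.1)
        (fun s : Res (toSite r) Lc (fine Lc M') => tdelta (fine Lc M') ((b.1 : Site (d + 1)) + unitVec b.2) s.1) e) with hT
  set Λb : Matrix (↥(pbox (fine Lc M')) × Fin (d + 1)) (↥(pbox (fine Lc M')) × Fin (d + 1)) ℝ :=
    Matrix.diagonal (fun b : ↥(pbox (fine Lc M')) × Fin (d + 1) => lam b.1) with hΛb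
  set Δ : Matrix (↥(pbox (fine Lc M')) × Fin (d + 1)) (↥(pbox (fine Lc M')) × Fin (d + 1)) ℝ :=
    Matrix.diagonal (fun b : ↥(pbox (fine Lc M')) × Fin (d + 1) => ∑ s, tgrad (fine Lc M') (b.1, Sum.inl b.2) s * lam s) with hΔ
  set Λt : Matrix (↥(pbox (fine Lc M')) × Fin (d + 1)) (↥(pbox (fine Lc M')) × Fin (d + 1)) ℝ :=
    Matrix.diagonal (fun b : ↥(pbox (fine Lc M')) × Fin (d + 1) => lam b.1 + ∑ s, tgrad (fine Lc M') (b.1, Sum.inl b.2) s * lam s) with hΛt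
  set Hd : Matrix (↥(pbox (fine Lc M')) × Fin (d + 1)) (↥(pbox (fine Lc M')) × Fin (d + 1)) ℝ :=
    Matrix.diagonal h with hHd
  set Θ : Matrix (↥(pbox (fine Lc M')) × Fin (d + 1)) (↥(pbox (fine Lc M')) × Fin (d + 1)) ℝ :=
    Matrix.diagonal (fun b : ↥(pbox (fine Lc M')) × Fin (d + 1) => h b + ∑ s, tgrad (fine Lc M') (b.1, Sum.inl b.2) s * lam s) with hΘ
  -- (★) and the tip rule
  have key1 : Λb * fromCols D₂ D₁ + Δ * T = fromCols D₂ D₁ * C₁ := torus_productRule M' lam hD₁ hD₂ hC₁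
  have key2 : T * C₁ = Λt * T := torus_tipRule M' lam hC₁
  have hWCC : fromCols D₂ D₁ * (C₁ * C₁) = Λb * (Λb * fromCols D₂ D₁ + Δ * T) + Δ * (Λt * T) := by
    rw [← Matrix.mul_assoc, ← key1, Matrix.add_mul, Matrix.mul_assoc, ← key1, Matrix.mul_assoc, key2]
  -- the closed forms as diagonal scalings of `T`
  have eW₁ : W₁ = -(c • (Hd * T)) := by
    rw [hW₁]; ext b e
    simp only [Matrix.neg_apply, Matrix.smul_apply, Matrix.diagonal_mul, Matrix.of_apply, smul_eq_mul, hHd, hT]; ring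
  have eW₁' : W₁' = -(c • (Θ * T)) := by
    rw [hW₁']; ext b e
    simp only [Matrix.neg_apply, Matrix.smul_apply, Matrix.diagonal_mul, Matrix.of_apply, smul_eq_mul, hΘ, hT]; ring
  have eW₂' : W₂' = W₂ + ((c * c) • (Θ * (Θ * T)) - (c * c) • (Hd * (Hd * T))) := by
    rw [hW₂']; ext b e
    simp only [Matrix.add_apply, Matrix.sub_apply, Matrix.smul_apply, Matrix.diagonal_mul, Matrix.of_apply, smul_eq_mul, hΘ, hHd, hT]; ring
  -- reduce every term to `(scalar) • diagonal · … · T` or `… · W₀`, then a scalar identity per entry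
  rw [eW₂', eW₁, eW₁', hX]
  simp only [neg_neg, neg_mul_neg, Matrix.mul_neg, Matrix.neg_mul, Matrix.smul_mul, Matrix.mul_smul, smul_smul, smul_neg,
    Matrix.mul_assoc, key2, hWCC]
  ext b e
  simp only [Matrix.add_apply, Matrix.sub_apply, Matrix.neg_apply, Matrix.smul_apply, Matrix.diagonal_mul, Matrix.mul_add, smul_eq_mul, hΛb, hΔ, hΛt,
    hHd, hΘ]
  ring

/-- [folklore] **`j2` OF `NestedStepLawTorusTransported` HOLDS EXACTLY AT THE RECORD FOR THE EXPONENTIAL GENERATOR JETS, WITH `W♯₂ := W₂^{(h+Dλ)}` AND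
`C₂ := (c•C₁)·(c•C₁)`.**  With the torus call's `hD₁ hD₂`, the field transport `X := −(c • diagonal (λ∘base))`, the parameter-transport generator `C₁(λ)`
(`hC₁` VERBATIM), the nested chart's generator jets in the closed forms `W₁ = of (−c·h b·Tip b e)`, **`W₂ = of ((c·h b)²·Tip b e)`** (hypothesis `hW₂`) and
the one-shot chart's `W♯₁ = of (−c·(h b + (Dλ) b)·Tip b e)`, `W♯₂ = of ((c·(h b + (Dλ) b))²·Tip b e)`: for EVERY weight `h` and EVERY site function `λ`,
`X·X·W₀ + 2 • (−X·W₁) + W₂ = W♯₂ + 2 • (W♯₁·(c•C₁)) + W₀·(c•C₁·(c•C₁))`, `W₀ = fromCols D₂ D₁` — `torus_j2_shift` with the shift absorbed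
(`(c·h)² + ((c·(h+Dλ))² − (c·h)²) = (c·(h+Dλ))²`).  The conclusion is the (B)∕RowsJ1 binder `j2` VERBATIM at `C₂ := c•C₁ * (c•C₁)`. -/
theorem torus_j2 (lam : ↥(pbox (fine Lc M')) → ℝ) (c : ℝ) (h : ↥(pbox (fine Lc M')) × Fin (d + 1) → ℝ)
    {D₁ : Matrix (↥(pbox (fine Lc M')) × Fin (d + 1)) (Res (toSite r) Lc (fine Lc M')) ℝ}
    {D₂ : Matrix (↥(pbox (fine Lc M')) × Fin (d + 1)) (Res (toSite r') Lc M') ℝ}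
    (hD₁ : D₁ = (tgrad (fine Lc M')).submatrix (fun b : ↥(pbox (fine Lc M')) × Fin (d + 1) => ((b.1, Sum.inl b.2) : Idx (fine Lc M') (Fib d)))
        (Subtype.val : Res (toSite r) Lc (fine Lc M') → ↥(pbox (fine Lc M'))))
    (hD₂ : D₂ = (tgradBlock M' Lc).submatrix (fun b : ↥(pbox (fine Lc M')) × Fin (d + 1) => ((b.1, Sum.inl b.2) : Idx (fine Lc M') (Fib d)))
        (Subtype.val : Res (toSite r') Lc M' → ↥(pbox M')))
    {C₁ : Matrix (Res (toSite r') Lc M' ⊕ Res (toSite r) Lc (fine Lc M')) (Res (toSite r') Lc M' ⊕ Res (toSite r) Lc (fine Lc M')) ℝ}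
    (hC₁ : C₁ = Matrix.fromBlocks
        (Matrix.diagonal fun t : Res (toSite r') Lc M' =>
          ∑ s, tdelta (fine Lc M') ((Lc : ℤ) • ((t.1 : ↥(pbox M')) : Site (d + 1)) + toSite r) s * lam s)
        (0 : Matrix (Res (toSite r') Lc M') (Res (toSite r) Lc (fine Lc M')) ℝ)
        (Matrix.of fun (s : Res (toSite r) Lc (fine Lc M')) (t : Res (toSite r') Lc M') =>
          (lam s.1 - ∑ s', tdelta (fine Lc M') ((Lc : ℤ) • ((t.1 : ↥(pbox M')) : Site (d + 1)) + toSite r) s' * lam s')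
            * tdelta M' (quo Lc ((s.1 : ↥(pbox (fine Lc M'))) : Site (d + 1))) t.1)
        (Matrix.diagonal fun s : Res (toSite r) Lc (fine Lc M') => lam s.1))
    {X : Matrix (↥(pbox (fine Lc M')) × Fin (d + 1)) (↥(pbox (fine Lc M')) × Fin (d + 1)) ℝ}
    (hX : X = -(c • Matrix.diagonal (fun b : ↥(pbox (fine Lc M')) × Fin (d + 1) => lam b.1)))
    {W₁ W₁' W₂ W₂' : Matrix (↥(pbox (fine Lc M')) × Fin (d + 1)) (Res (toSite r') Lc M' ⊕ Res (toSite r) Lc (fine Lc M')) ℝ}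
    (hW₁ : W₁ = Matrix.of fun (b : ↥(pbox (fine Lc M')) × Fin (d + 1)) (e : Res (toSite r') Lc M' ⊕ Res (toSite r) Lc (fine Lc M')) =>
        -(c * h b * Sum.elim (fun t : Res (toSite r') Lc M' => tdelta M' (quo Lc ((b.1 : Site (d + 1)) + unitVec b.2)) t.1)
          (fun s : Res (toSite r) Lc (fine Lc M') => tdelta (fine Lc M') ((b.1 : Site (d + 1)) + unitVec b.2) s.1) e))
    (hW₁' : W₁' = Matrix.of fun (b : ↥(pbox (fine Lc M')) × Fin (d + 1)) (e : Res (toSite r') Lc M' ⊕ Res (toSite r) Lc (fine Lc M')) =>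
        -(c * (h b + ∑ s, tgrad (fine Lc M') (b.1, Sum.inl b.2) s * lam s)
          * Sum.elim (fun t : Res (toSite r') Lc M' => tdelta M' (quo Lc ((b.1 : Site (d + 1)) + unitVec b.2)) t.1)
            (fun s : Res (toSite r) Lc (fine Lc M') => tdelta (fine Lc M') ((b.1 : Site (d + 1)) + unitVec b.2) s.1) e))
    (hW₂ : W₂ = Matrix.of fun (b : ↥(pbox (fine Lc M')) × Fin (d + 1)) (e : Res (toSite r') Lc M' ⊕ Res (toSite r) Lc (fine Lc M')) =>
        (c * h b) ^ 2 * Sum.elim (fun t : Res (toSite r') Lc M' => tdelta M' (quo Lc ((b.1 : Site (d + 1)) + unitVec b.2)) t.1)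
          (fun s : Res (toSite r) Lc (fine Lc M') => tdelta (fine Lc M') ((b.1 : Site (d + 1)) + unitVec b.2) s.1) e)
    (hW₂' : W₂' = Matrix.of fun (b : ↥(pbox (fine Lc M')) × Fin (d + 1)) (e : Res (toSite r') Lc M' ⊕ Res (toSite r) Lc (fine Lc M')) =>
        (c * (h b + ∑ s, tgrad (fine Lc M') (b.1, Sum.inl b.2) s * lam s)) ^ 2
          * Sum.elim (fun t : Res (toSite r') Lc M' => tdelta M' (quo Lc ((b.1 : Site (d + 1)) + unitVec b.2)) t.1)
            (fun s : Res (toSite r) Lc (fine Lc M') => tdelta (fine Lc M') ((b.1 : Site (d + 1)) + unitVec b.2) s.1) e) :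
    X * X * fromCols D₂ D₁ + (2 : ℝ) • (-X * W₁) + W₂ = W₂' + (2 : ℝ) • (W₁' * (c • C₁)) + fromCols D₂ D₁ * (c • C₁ * (c • C₁)) := by
  refine torus_j2_shift M' lam c h hD₁ hD₂ hC₁ hX hW₁ hW₁' ?_
  rw [hW₂', hW₂]; ext b e
  simp only [Matrix.add_apply, Matrix.of_apply]; ring

end OrderTwo

/-! ## §3 The dead rows in the closed forms (p319750 BY NAME): after this, (B)'s generator side is `hdead₁` + `hsmall₁` + the two closed forms -/

section DeadRows

variable (M' : Fin (d + 1) → ℕ) {Lc : ℕ} [NeZero Lc] {r r' : Fin (d + 1) → ℕ}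

/-- [folklore] **`p1`**: `P · W♯₁ = 0` for `W♯₁ = W₁^{(h+Dλ)}` in closed form, from `h + Dλ = 0` on the big-comb bonds (`torus_p_of_vanish_on_bigComb`). -/
theorem torus_p1_of_dead (hr : r ∈ box (d + 1) Lc) (hr' : r' ∈ box (d + 1) Lc) (hM' : ∀ i, Lc ∣ M' i)
    {P : Matrix (Res (toSite r') Lc M' ⊕ Res (toSite r) Lc (fine Lc M')) (↥(pbox (fine Lc M')) × Fin (d + 1)) ℝ}
    (hP : P = (combRowsT ((Lc : ℤ) • toSite r' + toSite r) (Lc * Lc) (fine Lc M')).submatrix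
        (resBigEquiv Lc Lc (toSite r) (toSite r') M' (Nat.pos_of_ne_zero (NeZero.ne Lc)) (toSite_mem_range hr)
          (Nat.pos_of_ne_zero (NeZero.ne Lc)) (toSite_mem_range hr')).symm
        (fun b : ↥(pbox (fine Lc M')) × Fin (d + 1) => ((b.1, Sum.inl b.2) : Idx (fine Lc M') (Fib d))))
    (lam : ↥(pbox (fine Lc M')) → ℝ) (c : ℝ) (h : ↥(pbox (fine Lc M')) × Fin (d + 1) → ℝ)
    {W₁' : Matrix (↥(pbox (fine Lc M')) × Fin (d + 1)) (Res (toSite r') Lc M' ⊕ Res (toSite r) Lc (fine Lc M')) ℝ}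
    (hW₁' : W₁' = Matrix.of fun (b : ↥(pbox (fine Lc M')) × Fin (d + 1)) (e : Res (toSite r') Lc M' ⊕ Res (toSite r) Lc (fine Lc M')) =>
        -(c * (h b + ∑ s, tgrad (fine Lc M') (b.1, Sum.inl b.2) s * lam s)
          * Sum.elim (fun t : Res (toSite r') Lc M' => tdelta M' (quo Lc ((b.1 : Site (d + 1)) + unitVec b.2)) t.1)
            (fun s : Res (toSite r) Lc (fine Lc M') => tdelta (fine Lc M') ((b.1 : Site (d + 1)) + unitVec b.2) s.1) e))
    (hdead : ∀ b : ↥(pbox (fine Lc M')) × Fin (d + 1), IsCombBondAt ((Lc : ℤ) • toSite r' + toSite r) (Lc * Lc) b.2 (b.1 : Site (d + 1)) →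
        h b + ∑ s, tgrad (fine Lc M') (b.1, Sum.inl b.2) s * lam s = 0) :
    P * W₁' = 0 :=
  torus_p_of_vanish_on_bigComb M' hr hr' hM' hP W₁' fun b hb => by
    rw [hW₁']; funext e; simp only [Matrix.of_apply, hdead b hb, mul_zero, zero_mul, neg_zero, Pi.zero_apply]

/-- [folklore] **`p2`**: `P · W♯₂ = 0` for `W♯₂ = W₂^{(h+Dλ)}` in the exponential closed form, from the SAME `h + Dλ = 0` on the big-comb bonds. -/
theorem torus_p2_of_dead (hr : r ∈ box (d + 1) Lc) (hr' : r' ∈ box (d + 1) Lc) (hM' : ∀ i, Lc ∣ M' i)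
    {P : Matrix (Res (toSite r') Lc M' ⊕ Res (toSite r) Lc (fine Lc M')) (↥(pbox (fine Lc M')) × Fin (d + 1)) ℝ}
    (hP : P = (combRowsT ((Lc : ℤ) • toSite r' + toSite r) (Lc * Lc) (fine Lc M')).submatrix
        (resBigEquiv Lc Lc (toSite r) (toSite r') M' (Nat.pos_of_ne_zero (NeZero.ne Lc)) (toSite_mem_range hr)
          (Nat.pos_of_ne_zero (NeZero.ne Lc)) (toSite_mem_range hr')).symm
        (fun b : ↥(pbox (fine Lc M')) × Fin (d + 1) => ((b.1, Sum.inl b.2) : Idx (fine Lc M') (Fib d))))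
    (lam : ↥(pbox (fine Lc M')) → ℝ) (c : ℝ) (h : ↥(pbox (fine Lc M')) × Fin (d + 1) → ℝ)
    {W₂' : Matrix (↥(pbox (fine Lc M')) × Fin (d + 1)) (Res (toSite r') Lc M' ⊕ Res (toSite r) Lc (fine Lc M')) ℝ}
    (hW₂' : W₂' = Matrix.of fun (b : ↥(pbox (fine Lc M')) × Fin (d + 1)) (e : Res (toSite r') Lc M' ⊕ Res (toSite r) Lc (fine Lc M')) =>
        (c * (h b + ∑ s, tgrad (fine Lc M') (b.1, Sum.inl b.2) s * lam s)) ^ 2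
          * Sum.elim (fun t : Res (toSite r') Lc M' => tdelta M' (quo Lc ((b.1 : Site (d + 1)) + unitVec b.2)) t.1)
            (fun s : Res (toSite r) Lc (fine Lc M') => tdelta (fine Lc M') ((b.1 : Site (d + 1)) + unitVec b.2) s.1) e)
    (hdead : ∀ b : ↥(pbox (fine Lc M')) × Fin (d + 1), IsCombBondAt ((Lc : ℤ) • toSite r' + toSite r) (Lc * Lc) b.2 (b.1 : Site (d + 1)) →
        h b + ∑ s, tgrad (fine Lc M') (b.1, Sum.inl b.2) s * lam s = 0) :
    P * W₂' = 0 :=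
  torus_p_of_vanish_on_bigComb M' hr hr' hM' hP W₂' fun b hb => by
    rw [hW₂']; funext e
    simp only [Matrix.of_apply, hdead b hb, mul_zero, ne_eq, OfNat.ofNat_ne_zero, not_false_eq_true, zero_pow, zero_mul, Pi.zero_apply]

/-- [folklore] **`s1`**: `τ₁ · W₁ = 0` for `W₁ = W₁^{(h)}` in closed form, from `h = 0` on the small-comb bonds (`torus_s_of_vanish_on_smallComb`). -/
theorem torus_s1_of_dead (hr : r ∈ box (d + 1) Lc)
    {τ₁ : Matrix (Res (toSite r) Lc (fine Lc M')) (↥(pbox (fine Lc M')) × Fin (d + 1)) ℝ}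
    (hτ₁ : τ₁ = (combRowsT (toSite r) Lc (fine Lc M')).submatrix id
        (fun b : ↥(pbox (fine Lc M')) × Fin (d + 1) => ((b.1, Sum.inl b.2) : Idx (fine Lc M') (Fib d))))
    (c : ℝ) (h : ↥(pbox (fine Lc M')) × Fin (d + 1) → ℝ)
    {W₁ : Matrix (↥(pbox (fine Lc M')) × Fin (d + 1)) (Res (toSite r') Lc M' ⊕ Res (toSite r) Lc (fine Lc M')) ℝ}
    (hW₁ : W₁ = Matrix.of fun (b : ↥(pbox (fine Lc M')) × Fin (d + 1)) (e : Res (toSite r') Lc M' ⊕ Res (toSite r) Lc (fine Lc M')) =>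
        -(c * h b * Sum.elim (fun t : Res (toSite r') Lc M' => tdelta M' (quo Lc ((b.1 : Site (d + 1)) + unitVec b.2)) t.1)
          (fun s : Res (toSite r) Lc (fine Lc M') => tdelta (fine Lc M') ((b.1 : Site (d + 1)) + unitVec b.2) s.1) e))
    (hsmall : ∀ b : ↥(pbox (fine Lc M')) × Fin (d + 1), IsCombBondAt (toSite r) Lc b.2 (b.1 : Site (d + 1)) → h b = 0) :
    τ₁ * W₁ = 0 :=
  torus_s_of_vanish_on_smallComb M' hr hτ₁ W₁ fun b hb => by
    rw [hW₁]; funext e; simp only [Matrix.of_apply, hsmall b hb, mul_zero, zero_mul, neg_zero, Pi.zero_apply]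

/-- [folklore] **`s2`**: `τ₁ · W₂ = 0` for `W₂ = W₂^{(h)}` in the exponential closed form, from the SAME `h = 0` on the small-comb bonds. -/
theorem torus_s2_of_dead (hr : r ∈ box (d + 1) Lc)
    {τ₁ : Matrix (Res (toSite r) Lc (fine Lc M')) (↥(pbox (fine Lc M')) × Fin (d + 1)) ℝ}
    (hτ₁ : τ₁ = (combRowsT (toSite r) Lc (fine Lc M')).submatrix id
        (fun b : ↥(pbox (fine Lc M')) × Fin (d + 1) => ((b.1, Sum.inl b.2) : Idx (fine Lc M') (Fib d))))
    (c : ℝ) (h : ↥(pbox (fine Lc M')) × Fin (d + 1) → ℝ)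
    {W₂ : Matrix (↥(pbox (fine Lc M')) × Fin (d + 1)) (Res (toSite r') Lc M' ⊕ Res (toSite r) Lc (fine Lc M')) ℝ}
    (hW₂ : W₂ = Matrix.of fun (b : ↥(pbox (fine Lc M')) × Fin (d + 1)) (e : Res (toSite r') Lc M' ⊕ Res (toSite r) Lc (fine Lc M')) =>
        (c * h b) ^ 2 * Sum.elim (fun t : Res (toSite r') Lc M' => tdelta M' (quo Lc ((b.1 : Site (d + 1)) + unitVec b.2)) t.1)
          (fun s : Res (toSite r) Lc (fine Lc M') => tdelta (fine Lc M') ((b.1 : Site (d + 1)) + unitVec b.2) s.1) e)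
    (hsmall : ∀ b : ↥(pbox (fine Lc M')) × Fin (d + 1), IsCombBondAt (toSite r) Lc b.2 (b.1 : Site (d + 1)) → h b = 0) :
    τ₁ * W₂ = 0 :=
  torus_s_of_vanish_on_smallComb M' hr hτ₁ W₂ fun b hb => by
    rw [hW₂]; funext e
    simp only [Matrix.of_apply, hsmall b hb, mul_zero, ne_eq, OfNat.ofNat_ne_zero, not_false_eq_true, zero_pow, zero_mul, Pi.zero_apply]

end DeadRows

end Summit.QuantumFields.BalabanUV.Beta.FP.TorusGeneratorIntertwiningTwo

end
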